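import Mathlib
import Summits.Ventures.HodgeRepro.Tier4.Common.AdelicRTF
import Summits.Ventures.HodgeRepro.Tier4.Common.LocalTorus
import Summits.Ventures.HodgeRepro.Tier4.Common.HaarProductTransport
import Summits.Ventures.HodgeRepro.Tier4.Line1.FiniteLevelIsolation
import Summits.Ventures.HodgeRepro.Tier4.Line1.LocallyCompactGA
import Summits.Ventures.HodgeRepro.Tier4.Line1.SecondCountableGA
import Summits.Ventures.HodgeRepro.Tier4.Line4.FinitePlacePositivity
import Summits.Ventures.HodgeRepro.Tier4.Line4.FinitePartClosed
import Summits.Ventures.HodgeRepro.Tier4.Line4.TorusProduct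

/-!
# Tier4/Line4/GASplit — C-L4-GASPLIT: `G(𝔸) ≃ G_∞ × G_f` as topological groups, Haar uniqueness on `G(𝔸)`, the
`G(𝔸)`-integral as an iterated `G_∞ × G_f` integral

Blind re-derivation cell `pub-hodge-repro`, Tier 4 «prove the step» (README §9–§10), seat t4-L4-p1 (prover, LINE L4,
gen 4; plan-4's cut C-L4-GASPLIT, S14443 Part A, statements of ProductTest-STATEMENTS.lean verbatim).  Tree path
`lean/Summits/Ventures/HodgeRepro/Tier4/Line4/GASplit.lean`.  Mathlib-level; no literature.

WHAT IS PROVED.  The group-level twin of C-L4-TORUSPROD (L2-p1's `TorusProduct`): the factorisation `g = g_∞ · g_f`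
(`GA.ofInfPart_mul_ofFinPart`, L1's FiniteLevelIsolation) is a continuous group isomorphism
`gaSplit : G(𝔸) ≃ₜ* G_∞ × G_f` (`infinitePart W` = «finite part `1`», `finitePart W` = «every archimedean component
`1`»), with inverse `(a, b) ↦ a · b`.  Its ingredients are the PARTS laws of `GA.ofInfPart` / `GA.ofFinPart`
(multiplicativity, the idempotent laws on the two factors, continuity — `TorusProduct`, `FinitePlacePositivity`).
On the measure side everything is typer-1's generic `HaarProductTransport` at `e := gaSplit W`:
* `isHaarMeasure_map_gaSplit_symm_prod` — the transported product of Haar measures of `G_∞`, `G_f` is a Haar measure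
  on `G(𝔸)`;
* `exists_smul_map_prod_eq_ga` — **Haar uniqueness on `G(𝔸)`**: every Haar measure `μ` on `G(𝔸)` is
  `c • (gaSplit⁻¹)_*(μ_∞ ⊗ μ_f)` with `c > 0` (L1-p5's `locallyCompact_GA` / `secondCountable_GA`; the factors are
  closed subgroups — `isClosed_infinitePart`, L4-p2's `isClosed_finitePart` — hence locally compact and second
  countable: `locallyCompact_infinitePart`, `secondCountable_finitePart`, …);
* `integral_eq_smul_integral_prod_ga` — for `μ = c • (gaSplit⁻¹)_*(μ_∞ ⊗ μ_f)` and `F` integrable,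
  `∫ F dμ = c ∫_{G_∞} ∫_{G_f} F(a b) dμ_f dμ_∞`.

Consumers: C-L4-CONVPROD (`ConvProduct`, this seat), C-L4-PROJPROD / INNERSPLIT (L4-p2), PRODINT (L2-p1).
Junk: `F = 0` gives `0 = c • 0`; `c = 0` is excluded by Haar uniqueness (`0 < c`).

Nothing here says anything about the status of the Hodge conjecture for CM abelian varieties, which is NOT proved
(HC_CM is NOT proved by anyone in this repository).
-/

set_option autoImplicit false
noncomputable section
namespace Summit.Ventures.HodgeRepro.Tier4.Line4
open Summit.Ventures.HodgeRepro.Tier4 Summit.Ventures.HodgeRepro.Tier4.Common NumberField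
  Summit.Ventures.HodgeRepro.Tier4.Line1 MeasureTheory
open scoped ComplexConjugate Topology Pointwise NNReal

/-! ## Part A — C-L4-GASPLIT: `G(𝔸) ≃ G_∞ × G_f`, Haar uniqueness, the iterated integral -/

section GASplit
variable {k : Type} [Field k] [NumberField k] (W : PlaneData k)

/-- The archimedean part, in `G_∞`. -/
def infG (g : GA W) : infinitePart W := ⟨GA.ofInfPart W g, GA.ofInfPart_mem_infinitePart W g⟩

/-- The finite part, in `G_f`. -/
def finG (g : GA W) : finitePart W := ⟨GA.ofFinPart W g, ofFinPart_mem_finitePart W g⟩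

/-- **THE SPLITTING `G(𝔸) ≃ G_∞ × G_f`** (`GA.ofInfPart_mul_ofFinPart`; `G_∞` and `G_f` commute, `ofFinPart_mul_ofInfPart_comm`). -/
def gaSplit : GA W ≃ₜ* infinitePart W × finitePart W where
  toFun g := (infG W g, finG W g)
  invFun p := (p.1 : GA W) * (p.2 : GA W)
  left_inv := by
    intro g
    exact GA.ofInfPart_mul_ofFinPart W g
  right_inv := by
    intro p
    refine Prod.ext (Subtype.ext ?_) (Subtype.ext ?_)
    · show GA.ofInfPart W ((p.1 : GA W) * (p.2 : GA W)) = (p.1 : GA W)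
      rw [ofInfPart_mul, ofInfPart_eq_self_of_mem_infinitePart W p.1.2,
        ofInfPart_eq_one_of_mem_finitePart W p.2.2, mul_one]
    · show GA.ofFinPart W ((p.1 : GA W) * (p.2 : GA W)) = (p.2 : GA W)
      rw [ofFinPart_mul, ofFinPart_eq_one_of_mem_infinitePart W p.1.2,
        ofFinPart_eq_self_of_mem_finitePart W p.2.2, one_mul]
  map_mul' := by
    intro g h
    refine Prod.ext (Subtype.ext ?_) (Subtype.ext ?_)
    · show GA.ofInfPart W (g * h) = GA.ofInfPart W g * GA.ofInfPart W h
      exact ofInfPart_mul W g h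
    · show GA.ofFinPart W (g * h) = GA.ofFinPart W g * GA.ofFinPart W h
      exact ofFinPart_mul W g h
  continuous_toFun :=
    ((continuous_ofInfPart W).subtype_mk _).prodMk ((continuous_ofFinPart W).subtype_mk _)
  continuous_invFun :=
    (continuous_subtype_val.comp continuous_fst).mul (continuous_subtype_val.comp continuous_snd)

/-- `gaSplit g = (g_∞, g_f)` (the first coordinate). -/
theorem coe_gaSplit_fst (g : GA W) : ((gaSplit W g).1 : GA W) = GA.ofInfPart W g := rfl

/-- `gaSplit g = (g_∞, g_f)` (the second coordinate). -/
theorem coe_gaSplit_snd (g : GA W) : ((gaSplit W g).2 : GA W) = GA.ofFinPart W g := rfl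

/-- The inverse of the splitting is the product `(a, b) ↦ a · b`. -/
theorem gaSplit_symm_apply (p : infinitePart W × finitePart W) :
    (gaSplit W).symm p = (p.1 : GA W) * (p.2 : GA W) := rfl

/-- `G_∞` is locally compact (closed in the locally compact `G(𝔸)`). -/
theorem locallyCompact_infinitePart : LocallyCompactSpace (infinitePart W) := by
  haveI := locallyCompact_GA W
  exact (isClosed_infinitePart W).locallyCompactSpace

/-- `G_f` is locally compact (closed in the locally compact `G(𝔸)`). -/
theorem locallyCompact_finitePart : LocallyCompactSpace (finitePart W) := by
  haveI := locallyCompact_GA W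
  exact (isClosed_finitePart W).locallyCompactSpace

/-- `G_∞` is second countable (a subspace of the second countable `G(𝔸)`). -/
theorem secondCountable_infinitePart : SecondCountableTopology (infinitePart W) := by
  haveI := secondCountable_GA W
  exact Topology.IsEmbedding.subtypeVal.secondCountableTopology

/-- `G_f` is second countable (a subspace of the second countable `G(𝔸)`). -/
theorem secondCountable_finitePart : SecondCountableTopology (finitePart W) := by
  haveI := secondCountable_GA W
  exact Topology.IsEmbedding.subtypeVal.secondCountableTopology

section Measure
variable [MeasurableSpace (GA W)] [BorelSpace (GA W)]

/-- The transported product of Haar measures on `G_∞`, `G_f` is a Haar measure on `G(𝔸)`. -/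
theorem isHaarMeasure_map_gaSplit_symm_prod
    (μinf : Measure (infinitePart W)) [μinf.IsHaarMeasure] (μfin : Measure (finitePart W)) [μfin.IsHaarMeasure] :
    (Measure.map (gaSplit W).symm (μinf.prod μfin)).IsHaarMeasure := by
  haveI := locallyCompact_infinitePart W
  haveI := locallyCompact_finitePart W
  haveI := secondCountable_infinitePart W
  haveI := secondCountable_finitePart W
  exact isHaarMeasure_map_symm_prod (gaSplit W) μinf μfin

/-- **HAAR UNIQUENESS ON `G(𝔸)`** (`locallyCompact_GA`, `secondCountable_GA`). -/
theorem exists_smul_map_prod_eq_ga (μ : Measure (GA W)) [μ.IsHaarMeasure]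
    (μinf : Measure (infinitePart W)) [μinf.IsHaarMeasure] (μfin : Measure (finitePart W)) [μfin.IsHaarMeasure] :
    ∃ c : ℝ≥0, 0 < c ∧ μ = c • Measure.map (gaSplit W).symm (μinf.prod μfin) := by
  haveI := locallyCompact_GA W
  haveI := secondCountable_GA W
  haveI := locallyCompact_infinitePart W
  haveI := locallyCompact_finitePart W
  haveI := secondCountable_infinitePart W
  haveI := secondCountable_finitePart W
  exact exists_smul_map_symm_prod_eq (gaSplit W) μ μinf μfin

/-- **THE `G(𝔸)`-INTEGRAL AS AN ITERATED `G_∞ × G_f` INTEGRAL**. -/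
theorem integral_eq_smul_integral_prod_ga (μ : Measure (GA W)) [μ.IsHaarMeasure]
    (μinf : Measure (infinitePart W)) [μinf.IsHaarMeasure] (μfin : Measure (finitePart W)) [μfin.IsHaarMeasure]
    (c : ℝ≥0) (hc : μ = c • Measure.map (gaSplit W).symm (μinf.prod μfin))
    (F : GA W → ℂ) (hF : Integrable F μ) :
    ∫ g, F g ∂μ = (c : ℝ) • ∫ a, ∫ b, F ((a : GA W) * (b : GA W)) ∂μfin ∂μinf := by
  haveI := locallyCompact_infinitePart W
  haveI := locallyCompact_finitePart W
  haveI := secondCountable_infinitePart W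
  haveI := secondCountable_finitePart W
  exact integral_eq_smul_integral_prod (gaSplit W) μ μinf μfin c hc F hF

end Measure
end GASplit

end Summit.Ventures.HodgeRepro.Tier4.Line4
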